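import Literature.InformationTheory.QuantumCodes.PlanarCodeSpaceTimePathsBound
import Literature.InformationTheory.QuantumCodes.InhomogeneousDensityBound
import HarnessLib

/-!
# The planar space-time counting bound with TWO rates (`p` on qubits, `q` on measurements):
# `Prob[odd-crossing residual] ≤ (k+2)·T·C·r(ρ)^{k+2}/(1-r(ρ))` for `p, q ≤ ρ ≤ 1/2`, `r(ρ) = 2ν√(ρ(1-ρ))`

Topic `Literature/InformationTheory/QuantumCodes` (venture QEC, LADDER-QEC rung Q5, PARTITION row 09 "phenomenological";
qec-type-09 gen 6, cell item 09.PSAW (C′)). All PROVED, kernel axioms, no named fact. `PlanarCodeSpaceTimePathsBound.lean`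
bounds the odd-crossing-residual probability of the planar memory experiment for EQUAL rates `q = p` through the i.i.d.
half-density bound. Dennis–Kitaev–Landahl–Preskill's statement is a BOX in the two rates ("Errors on horizontal links
occur with probability p, and errors on vertical links occur with probability q", §4.2; threshold "provided that …
p, q < .0114" in their numerics, §5.3). With the tree's inhomogeneous Peierls bound `sum_indepWeight_le_of_cover`
(`InhomogeneousDensityBound.lean`: rates `≤ ρ ≤ 1/2` ⇒ `(2√(ρ(1-ρ)))^{|T|}` per path) the same covering family of
rough-to-rough self-avoiding space-time paths gives:

* ★ `st_sum_oddResidual_le_twoRate` — for a minimum-weight space-time decoder, rates `0 ≤ p, q ≤ ρ ≤ 1/2` and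
  `cₙ(ℤ³) ≤ C νⁿ` with `r = 2ν√(ρ(1-ρ)) < 1`: `Σ_{E : odd-crossing residual} w_{p,q}(E) ≤ (k+2)·T·C·r^{k+2}/(1-r)`;
* `st_tendsto_sum_oddResidual_twoRate` — hence for `4ν² ρ(1-ρ) < 1` and polynomially many rounds these sums tend to `0`
  at every rate pair in the box `[0, ρ]²`.

## References

* [DennisEtAl2002] E. Dennis, A. Kitaev, A. Landahl, J. Preskill, *Topological quantum memory*, J. Math. Phys. 43 (2002)
  4452–4505, arXiv:quant-ph/0110143, §4.2 (rates `p`, `q`), §5.2 (eqs. (saw_prob), (saw_L)), §5.3 (eqs. (saw_3),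
  (threshold_iso_num): the box `p, q < .0114`; planar codes: "This change has no effect on the estimate of the threshold").
-/

namespace Literature.InformationTheory.QuantumCodes

namespace PlanarCode

open Finset Matrix Filter Topology CSSPhenom
open Literature.Probability.LatticeModels (Site)
open Literature.Probability.RandomPlanarGeometry
open Literature.Probability.RandomPlanarGeometry.SAW.Zd (saws card_saws)

variable {k T : ℕ}

/-- A history is determined by its support. [folklore] -/
private theorem supp_injective'' {V : Type*} [Fintype V] [DecidableEq V] :
    Function.Injective (supp : (V → ZMod 2) → Finset V) := by
  intro e₁ e₂ h
  funext v
  have h1 : v ∈ supp e₁ ↔ v ∈ supp e₂ := by rw [h]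
  simp only [supp, Finset.mem_filter, Finset.mem_univ, true_and] at h1
  have key : ∀ x y : ZMod 2, (x ≠ 0 ↔ y ≠ 0) → x = y := by decide
  exact key _ _ h1

/-- The walk-count constant is at least `1` (`c₀ = 1`), in particular non-negative. [cite: DennisEtAl2002, §5.3 eq. (saw_3)] -/
private theorem nonneg_of_sawCountBound3' {C ν : ℝ} (h : ToricCode.SAWCountBound3 C ν) : 0 ≤ C := by
  have h0 := h 0
  rw [SAW.Zd.count_zero, pow_zero, mul_one, Nat.cast_one] at h0
  linarith

/-- The two phenomenological rates are non-negative when `p, q` are. [cite: DennisEtAl2002, §4.2 (rates p, q)] -/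
private theorem phenomRate_nonneg {p q : ℝ} (hp : 0 ≤ p) (hq : 0 ≤ q)
    (ℓ : HistoryLoc (PlanarQubit k) (PlanarCheck k) T) : 0 ≤ phenomRate p q ℓ := by
  rcases ℓ with ℓ | ℓ <;> simp [phenomRate, hp, hq]

/-- The two phenomenological rates are `≤ ρ` when `p, q ≤ ρ`. [cite: DennisEtAl2002, §4.2 (rates p, q)] -/
private theorem phenomRate_le {p q ρ : ℝ} (hp : p ≤ ρ) (hq : q ≤ ρ)
    (ℓ : HistoryLoc (PlanarQubit k) (PlanarCheck k) T) : phenomRate p q ℓ ≤ ρ := by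
  rcases ℓ with ℓ | ℓ <;> simp [phenomRate, hp, hq]

open Classical in
/-- ★ **DKLP's counting bound for the planar memory experiment with TWO rates** (`p` on qubit faults, `q` on measurement
faults, both `≤ ρ ≤ 1/2`): for a minimum-weight space-time decoder `D` and a walk-count bound `cₙ(ℤ³) ≤ C νⁿ` with
`r = 2ν√(ρ(1-ρ)) < 1`, the total probability of the histories whose residual projects to an odd bottom crossing is at most
`(k+2)·T·C·r^{k+2}/(1-r)` — the same covering family as for `q = p`, with the inhomogeneous Peierls bound
`(2√(ρ(1-ρ)))ⁿ` per path of `n` bonds. [cite: DennisEtAl2002, §5.2 eqs. (saw_prob), (saw_L), §5.3 eq. (threshold_iso_num) (the box p, q)] -/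
theorem st_sum_oddResidual_le_twoRate {C ν : ℝ} (hν : 0 < ν) (hC : ToricCode.SAWCountBound3 C ν)
    {D : STDecoder (PlanarCheck k) (PlanarQubit k) T}
    (hD : D.IsMinWeight (stSyn (planarHX k) T) (stCycles (planarHX k) T) hammingNorm)
    {p q ρ : ℝ} (hp0 : 0 ≤ p) (hq0 : 0 ≤ q) (hpρ : p ≤ ρ) (hqρ : q ≤ ρ) (hρ : ρ ≤ 1 / 2)
    (hr1 : 2 * ν * Real.sqrt (ρ * (1 - ρ)) < 1) :
    ∑ E ∈ univ.filter (fun E : History (PlanarCheck k) (PlanarQubit k) T =>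
        ∑ b : Fin (k + 2), proj (D (stSyn (planarHX k) T E) + E) (Sum.inl (0, b)) = 1),
        phenomenologicalWeight T p q (supp E) ≤
      ((k : ℝ) + 2) * T * C * (2 * ν * Real.sqrt (ρ * (1 - ρ))) ^ (k + 2) / (1 - 2 * ν * Real.sqrt (ρ * (1 - ρ))) := by
  classical
  set s := Real.sqrt (ρ * (1 - ρ)) with hs
  set r := 2 * ν * s with hr
  have hs0 : 0 ≤ s := Real.sqrt_nonneg _
  have hr0 : 0 ≤ r := by rw [hr]; positivity
  have h1r : 0 < 1 - r := by linarith
  have hC0 : 0 ≤ C := nonneg_of_sawCountBound3' hC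
  -- Step 1: the odd-residual histories, reindexed by their supports
  set F := univ.filter (fun E : History (PlanarCheck k) (PlanarQubit k) T =>
    ∑ b : Fin (k + 2), proj (D (stSyn (planarHX k) T E) + E) (Sum.inl (0, b)) = 1) with hF
  have hsum : ∑ E ∈ F, phenomenologicalWeight T p q (supp E) =
      ∑ S ∈ F.image supp, indepWeight (phenomRate p q) S := by
    rw [Finset.sum_image fun e₁ _ e₂ _ h => supp_injective'' h]
    rfl
  rw [hsum]
  -- Step 2: the covering family — rough-to-rough self-avoiding space-time paths graded by their number of bonds
  set M := Fintype.card (HistoryLoc (PlanarQubit k) (PlanarCheck k) T) with hM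
  set I : Finset (Σ _ : ℕ, (Fin (k + 2) × Fin T) × (ℕ → Site 3)) :=
    (Finset.Ico (k + 2) (M + 1)).sigma fun n => (univ : Finset (Fin (k + 2) × Fin T)) ×ˢ saws 3 n with hI
  set Ps : Finset (Σ _ : ℕ, (Fin (k + 2) × Fin T) × (ℕ → Site 3)) :=
    I.filter (fun x => IsSTCrossing k T x.2.1.1 x.2.1.2 x.1 x.2.2) with hPs
  set Tm : (Σ _ : ℕ, (Fin (k + 2) × Fin T) × (ℕ → Site 3)) → Finset (HistoryLoc (PlanarQubit k) (PlanarCheck k) T) :=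
    fun x => pathLocs x.2.1.1 x.2.1.2 x.1 x.2.2 with hTm
  have hmem : ∀ x ∈ Ps, x.2.2 ∈ saws 3 x.1 ∧ IsSTCrossing k T x.2.1.1 x.2.1.2 x.1 x.2.2 := by
    intro x hx
    rw [hPs, Finset.mem_filter, hI, Finset.mem_sigma, Finset.mem_product] at hx
    exact ⟨hx.1.2.2, hx.2⟩
  have hcard : ∀ x ∈ Ps, (Tm x).card = x.1 := fun x hx => card_pathLocs (hmem x hx).1 (hmem x hx).2
  have hcover : ∀ S ∈ F.image supp, ∃ x ∈ Ps, (Tm x).card ≤ 2 * (Tm x ∩ S).card := by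
    intro S hS
    obtain ⟨E, hE, rfl⟩ := Finset.mem_image.1 hS
    have hodd := (Finset.mem_filter.1 hE).2
    obtain ⟨b₀, t₀, n, ω, hω, hX, hkn, hhalf⟩ := st_exists_crossing_of_oddResidual hD hodd
    have hnM : n ≤ M := by
      rw [← card_pathLocs hω hX]
      exact Finset.card_le_univ _
    refine ⟨⟨n, (b₀, t₀), ω⟩, ?_, ?_⟩
    · rw [hPs, Finset.mem_filter, hI, Finset.mem_sigma, Finset.mem_product, Finset.mem_Ico]
      exact ⟨⟨⟨hkn, Nat.lt_succ_of_le hnM⟩, Finset.mem_univ _, hω⟩, hX⟩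
    · show (pathLocs b₀ t₀ n ω).card ≤ 2 * (pathLocs b₀ t₀ n ω ∩ supp E).card
      rw [card_pathLocs hω hX]
      exact hhalf
  have h1 := sum_indepWeight_le_of_cover (phenomRate_nonneg hp0 hq0) (phenomRate_le hpρ hqρ) hρ Ps Tm
    (F.image supp) hcover
  -- Step 3: `Σ_{paths} (2s)^n ≤ Σ_{n} (k+2)·T·cₙ·(2s)^n`
  have h2 : ∑ x ∈ Ps, (2 * s) ^ (Tm x).card ≤ ∑ x ∈ I, (2 * s) ^ x.1 :=
    calc ∑ x ∈ Ps, (2 * s) ^ (Tm x).card = ∑ x ∈ Ps, (2 * s) ^ x.1 :=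
          Finset.sum_congr rfl fun x hx => by rw [hcard x hx]
      _ ≤ ∑ x ∈ I, (2 * s) ^ x.1 :=
          Finset.sum_le_sum_of_subset_of_nonneg (Finset.filter_subset _ _) fun _ _ _ => pow_nonneg (by positivity) _
  have h3 : ∑ x ∈ I, (2 * s) ^ x.1 =
      ∑ n ∈ Finset.Ico (k + 2) (M + 1), ((k : ℝ) + 2) * T * ((saws 3 n).card : ℝ) * (2 * s) ^ n := by
    rw [hI, Finset.sum_sigma]
    refine Finset.sum_congr rfl fun n _ => ?_
    show ∑ y ∈ (univ : Finset (Fin (k + 2) × Fin T)) ×ˢ saws 3 n, (2 * s) ^ n = _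
    rw [Finset.sum_const, Finset.card_product, Finset.card_univ, Fintype.card_prod, Fintype.card_fin, Fintype.card_fin,
      nsmul_eq_mul]
    push_cast
    ring
  -- Step 4: `cₙ ≤ C νⁿ` and the geometric tail
  have h4 : ∀ n ∈ Finset.Ico (k + 2) (M + 1),
      ((k : ℝ) + 2) * T * ((saws 3 n).card : ℝ) * (2 * s) ^ n ≤ ((k : ℝ) + 2) * T * C * r ^ n := by
    intro n _
    have hc : ((saws 3 n).card : ℝ) ≤ C * ν ^ n := by
      rw [card_saws]
      exact hC n
    have hk : (0 : ℝ) ≤ ((k : ℝ) + 2) * T := by positivity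
    calc ((k : ℝ) + 2) * T * ((saws 3 n).card : ℝ) * (2 * s) ^ n ≤ ((k : ℝ) + 2) * T * (C * ν ^ n) * (2 * s) ^ n :=
          mul_le_mul_of_nonneg_right (mul_le_mul_of_nonneg_left hc hk) (pow_nonneg (by positivity) _)
      _ = ((k : ℝ) + 2) * T * C * r ^ n := by
          rw [hr, mul_pow, mul_pow, mul_pow]
          ring
  have hgeom := geom_tail_le hr0 hr1 (k + 2) (M + 1)
  calc ∑ S ∈ F.image supp, indepWeight (phenomRate p q) S
      ≤ ∑ x ∈ Ps, (2 * s) ^ (Tm x).card := h1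
    _ ≤ ∑ x ∈ I, (2 * s) ^ x.1 := h2
    _ = ∑ n ∈ Finset.Ico (k + 2) (M + 1), ((k : ℝ) + 2) * T * ((saws 3 n).card : ℝ) * (2 * s) ^ n := h3
    _ ≤ ∑ n ∈ Finset.Ico (k + 2) (M + 1), ((k : ℝ) + 2) * T * C * r ^ n := Finset.sum_le_sum h4
    _ = ((k : ℝ) + 2) * T * C * ∑ n ∈ Finset.Ico (k + 2) (M + 1), r ^ n := by rw [Finset.mul_sum]
    _ ≤ ((k : ℝ) + 2) * T * C * (r ^ (k + 2) / (1 - r)) := mul_le_mul_of_nonneg_left hgeom (by positivity)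
    _ = ((k : ℝ) + 2) * T * C * r ^ (k + 2) / (1 - r) := by ring

open Classical in
/-- **The two-rate planar space-time counting bound tends to zero in the box `[0, ρ]²` when `4ν² ρ(1-ρ) < 1`**
(`cₙ(ℤ³) ≤ C νⁿ`, polynomially bounded schedule `T(k)`, minimum-weight space-time decoders): at every rate pair
`0 ≤ p, q ≤ ρ` the probability of an odd-crossing residual tends to `0` as `k → ∞`.
[cite: DennisEtAl2002, §5.3 eqs. (threshold_iso), (threshold_iso_num)] -/
theorem st_tendsto_sum_oddResidual_twoRate {C ν : ℝ} (hν : 0 < ν) (hC : ToricCode.SAWCountBound3 C ν)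
    {Tk : ℕ → ℕ} (hT : ToricCode.IsPolyBounded Tk)
    (D : ∀ k, STDecoder (PlanarCheck k) (PlanarQubit k) (Tk k))
    (hD : ∀ k, (D k).IsMinWeight (stSyn (planarHX k) (Tk k)) (stCycles (planarHX k) (Tk k)) hammingNorm)
    {p q ρ : ℝ} (hp0 : 0 ≤ p) (hq0 : 0 ≤ q) (hpρ : p ≤ ρ) (hqρ : q ≤ ρ) (hρ : ρ ≤ 1 / 2)
    (h4 : 4 * ν ^ 2 * (ρ * (1 - ρ)) < 1) :
    Tendsto (fun k => ∑ E ∈ univ.filter (fun E : History (PlanarCheck k) (PlanarQubit k) (Tk k) =>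
        ∑ b : Fin (k + 2), proj (D k (stSyn (planarHX k) (Tk k) E) + E) (Sum.inl (0, b)) = 1),
        phenomenologicalWeight (Tk k) p q (supp E)) atTop (𝓝 0) := by
  set s := Real.sqrt (ρ * (1 - ρ)) with hs
  set r := 2 * ν * s with hr
  have hs0 : 0 ≤ s := Real.sqrt_nonneg _
  have hr0 : 0 ≤ r := by rw [hr]; positivity
  have hρ0 : 0 ≤ ρ := hp0.trans hpρ
  have hρρ : 0 ≤ ρ * (1 - ρ) := mul_nonneg hρ0 (by linarith)
  have hr1 : r < 1 := by
    have hsq : r ^ 2 = 4 * ν ^ 2 * (ρ * (1 - ρ)) := by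
      rw [hr, mul_pow, mul_pow, hs, Real.sq_sqrt hρρ]
      ring
    have h : r ^ 2 < 1 := by rw [hsq]; exact h4
    have := (sq_lt_one_iff_abs_lt_one r).1 h
    rwa [abs_of_nonneg hr0] at this
  have h1r : 0 < 1 - r := by linarith
  have hC0 : 0 ≤ C := nonneg_of_sawCountBound3' hC
  obtain ⟨A, m, hA⟩ := hT
  have hbound : ∀ k : ℕ, (∑ E ∈ univ.filter (fun E : History (PlanarCheck k) (PlanarQubit k) (Tk k) =>
        ∑ b : Fin (k + 2), proj (D k (stSyn (planarHX k) (Tk k) E) + E) (Sum.inl (0, b)) = 1),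
        phenomenologicalWeight (Tk k) p q (supp E)) ≤
      ((k : ℝ) + 2) * (A * ((k : ℝ) + 1) ^ m) * C * r ^ (k + 2) / (1 - r) := by
    intro k
    refine (st_sum_oddResidual_le_twoRate hν hC (hD k) hp0 hq0 hpρ hqρ hρ hr1).trans ?_
    have hk : (0 : ℝ) ≤ (k : ℝ) + 2 := by positivity
    have h1 : ((k : ℝ) + 2) * (Tk k : ℝ) * C ≤ ((k : ℝ) + 2) * (A * ((k : ℝ) + 1) ^ m) * C :=
      mul_le_mul_of_nonneg_right (mul_le_mul_of_nonneg_left (hA k) hk) hC0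
    exact div_le_div_of_nonneg_right (mul_le_mul_of_nonneg_right h1 (pow_nonneg hr0 _)) h1r.le
  have hnonneg : ∀ k : ℕ, 0 ≤ ∑ E ∈ univ.filter (fun E : History (PlanarCheck k) (PlanarQubit k) (Tk k) =>
        ∑ b : Fin (k + 2), proj (D k (stSyn (planarHX k) (Tk k) E) + E) (Sum.inl (0, b)) = 1),
        phenomenologicalWeight (Tk k) p q (supp E) := by
    intro k
    refine Finset.sum_nonneg fun E _ => ?_
    exact indepWeight_nonneg (phenomRate_nonneg hp0 hq0)
      (fun ℓ => (phenomRate_le hpρ hqρ ℓ).trans (by linarith)) _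
  have hlim : Tendsto (fun k : ℕ => ((k : ℝ) + 2) * (A * ((k : ℝ) + 1) ^ m) * C * r ^ (k + 2) / (1 - r))
      atTop (𝓝 0) := by
    have h0 := tendsto_pow_const_mul_const_pow_of_abs_lt_one (m + 1) (show |r| < 1 by rwa [abs_of_nonneg hr0])
    have h1 : Tendsto (fun k : ℕ => ((k + 1 : ℕ) : ℝ) ^ (m + 1) * r ^ (k + 1)) atTop (𝓝 0) :=
      (Filter.tendsto_add_atTop_iff_nat 1).2 h0
    have h2 := h1.const_mul (2 * A * C * r / (1 - r))
    rw [mul_zero] at h2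
    have hle : ∀ k : ℕ, ((k : ℝ) + 2) * (A * ((k : ℝ) + 1) ^ m) * C * r ^ (k + 2) / (1 - r) ≤
        2 * A * C * r / (1 - r) * (((k + 1 : ℕ) : ℝ) ^ (m + 1) * r ^ (k + 1)) := by
      intro k
      have hk2 : (k : ℝ) + 2 ≤ 2 * ((k : ℝ) + 1) := by linarith [(Nat.cast_nonneg k : (0 : ℝ) ≤ k)]
      have hX : 0 ≤ A * ((k : ℝ) + 1) ^ m * C * r ^ (k + 2) / (1 - r) := by
        have hA0 : 0 ≤ A * ((k : ℝ) + 1) ^ m := (Nat.cast_nonneg (Tk k)).trans (hA k)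
        positivity
      calc ((k : ℝ) + 2) * (A * ((k : ℝ) + 1) ^ m) * C * r ^ (k + 2) / (1 - r)
          = ((k : ℝ) + 2) * (A * ((k : ℝ) + 1) ^ m * C * r ^ (k + 2) / (1 - r)) := by ring
        _ ≤ 2 * ((k : ℝ) + 1) * (A * ((k : ℝ) + 1) ^ m * C * r ^ (k + 2) / (1 - r)) :=
            mul_le_mul_of_nonneg_right hk2 hX
        _ = 2 * A * C * r / (1 - r) * (((k + 1 : ℕ) : ℝ) ^ (m + 1) * r ^ (k + 1)) := by
            push_cast
            ring
    have hnn : ∀ k : ℕ, 0 ≤ ((k : ℝ) + 2) * (A * ((k : ℝ) + 1) ^ m) * C * r ^ (k + 2) / (1 - r) := fun k => by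
      have hA0 : 0 ≤ A * ((k : ℝ) + 1) ^ m := (Nat.cast_nonneg (Tk k)).trans (hA k)
      positivity
    exact squeeze_zero hnn hle h2
  exact squeeze_zero hnonneg hbound hlim

end PlanarCode

end Literature.InformationTheory.QuantumCodes
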